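import Mathlib
import Summits.PneNP.PneNP.Theses.Nc03AvoidResidualCore
import Summits.PneNP.PneNP.Theorems.Nc03AvoidResidualCoreCandCherry

/-!
# Route Nc03AvoidResidualCore, item `CandStarReduction` (★) — the registered skeleton's objects

Definitions file for `stmt-PneNP-19963` (cell pnp-ideate, route `Nc03AvoidResidualCore`, crux X₂
`Summit.PneNP.PneNP.Theses.Nc03AvoidResidualCore.CandStarReduction : CandMatchAvoidLinearFP →
CandAvoidLinearFP`, the ★-reduction of the cell memo pnp-ideate-p2/ROUND-3-ADDENDUM-B, Thm B.1).

The registered birth skeleton `Summits/PneNP/PneNP/Cruxes/CandStarReduction/Lines/birth.lean`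
(tribunal-w g6, sha ffbde7a1…) is a crux workfile and not an importable module; this file carries
its one object VERBATIM so that the two stub files and the closer can share it:

* `TangledSurplusFP` — ONE polynomial-time avoider for every pure-`CAND` instance with at least
  `n + 1` tangled outputs (`…Nc03AvoidResidualCoreCandCherry.tangled`, landed p487884); the
  statement of the registered stub `stub_cherryStar : TangledSurplusFP`;
* `candStarReduction_of_stubs` — the skeleton's sorry-free composition: the two registered stub
  STATEMENTS (`stub_cherryStar : TangledSurplusFP`, `stub_tangledSplit : CandMatchAvoidLinearFP →
  TangledSurplusFP → CandAvoidLinearFP`) imply the crux, concluded BY NAME (the route's fq decl, no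
  local shadow).

Restricted-model (NC⁰₃) range-avoidance rung F-N1b of the PneNP frontier ladder (an ALGORITHMIC
reduction between two restricted AVOID problems); nothing here bears on P vs NP.
-/

set_option linter.dupNamespace false -- `Summit.PneNP.PneNP.…`: summit = sub-problem name (D-0017 single-conjunct layout)

namespace Summit.PneNP.PneNP.Theorems.Nc03CandStar

open Finset
open Literature.Computability.Complexity
open Summit.PneNP.PneNP.Theses.Nc03AvoidResidualCore
  (CandMatchAvoidLinearFP CandStarReduction CandAvoidLinearFP)
open Summit.PneNP.PneNP.Theorems.Nc03AvoidResidualCoreCandCherry (tangled)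

/-- ★-core as a Prop (cell memo ROUND-3-ADDENDUM-B, Thm B.1, first sentence): ONE polynomial-time
avoider for every pure-`CAND` instance with at least `n + 1` tangled outputs. VERBATIM the
registered skeleton's `TangledSurplusFP` (Cruxes/CandStarReduction/Lines/birth.lean). -/
def TangledSurplusFP : Prop :=
  ∃ f : List Bool → List Bool, IsPolyTime f ∧
    ∀ n m (I : LocalMap 3 n m), I.IsPure candPred → 0 < n → n + 1 ≤ #(tangled I) →
      readOut m (f I.encode) ∉ I.range

/-- The skeleton's ASSEMBLY (kernel-checked, no sorry): the two registered stub statements —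
`stub_cherryStar : TangledSurplusFP` and `stub_tangledSplit : CandMatchAvoidLinearFP →
TangledSurplusFP → CandAvoidLinearFP` — imply the crux
`Summit.PneNP.PneNP.Theses.Nc03AvoidResidualCore.CandStarReduction`, concluded BY NAME. -/
theorem candStarReduction_of_stubs (h₁ : TangledSurplusFP)
    (h₂ : CandMatchAvoidLinearFP → TangledSurplusFP → CandAvoidLinearFP) :
    Summit.PneNP.PneNP.Theses.Nc03AvoidResidualCore.CandStarReduction :=
  fun hX₁ => h₂ hX₁ h₁

end Summit.PneNP.PneNP.Theorems.Nc03CandStar
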